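/-
Copyright: the b2b-balaban T⁴-continuum CRUX team, row NE7b leaf lineage `t4-ne7b-formalise-leaf-02` (gen 135). Project licence.
-/
import Summits.QuantumFields.BalabanUV.T4Continuum.Spine.NE7b.SineTentQuadraticPartition

/-!
# THE SINE-TENT PARTITION's SUMMED-SQUARE DISPLACEMENT LETTER: one lattice step costs `Σ_b (g_b(a+1) − g_b(a))² ≤ (π∕2L)²` on an axis (the alive pair is
# `(sin α, cos α) → (sin β, cos β)`, `(Δsin)² + (Δcos)² = 2 − 2cos(α − β) ≤ (α − β)²`), the quadratic product turns it into `Σ_S (h_S(ξ′) − h_S(ξ))² ≤ (π∕2L)²`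
# EXACTLY (off the moving axis `Σ g² = 1`), and `D` moves give `Σ_S (h_S(pt b) − h_S(pt ref))² ≤ (D·π∕2L)²` by the `ℓ²(cubes)` triangle inequality — the letter
# `hsq` of `…AdmissibleFloorSqLetter` with `Λ = D·π∕(2L)`, the SAME number as the sup letter `λ` of `…SineTentQuadraticPartition`, so the multiplicity `μ` is gone
# (row NE7b, node U5c; residual (R2′) family (2), letter (ℓ1); the refuter's located item Q-v128-1, PRICING-NE7b v128: «E′·L² = 6π² ≈ 59 (÷16)» for d = 4 plaquettes)

Cell `pub-balaban`, sub-cell `t4`, spine estimate NE7b (`T4WeightBudget.RelWeightBound`; the cell's OWN estimate — NOT PRINTED in [Bałaban 1983–89],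
NOT PROVED).  Crux-route work under `Spine/NE7b/` by a row leaf (`t4-ne7b-formalise-leaf-02`, E-side ∕ key-readings ∕ lattice-geometry lineage, gen 135)
under FREEZE (0)'s crux-prover clause; [folklore] trigonometry and bookkeeping over this lineage's partition files; NOTHING of Bałaban's is asserted; no `def`;
zero `sorry`; no `T4Continuum/Support` leaf.  Import: `…SineTentQuadraticPartition` (STQ; through it STA `…SineTentAxis` (`sin_tent_eq_zero_iff`), TUS
`…TentUnityTorusSupport` (`filter_tentZ_ne_zero_subset_pair` ∕ `_add_one_subset_pair`), TZS `…TentUnityTorusSteps` (`abs_tentZ_add_one_sub_le`), TPP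
`…TentPartitionProduct` (`prod_update_sub`), TPTo `…TentPartitionTorus` (`exists_chain`, `hdisp_of_unit`), PPaL `…PartitionPathLetters` (`sum_sq_path_le_of_le`),
`Literature.….B14TentUnityTorus` (`tentZ`, `sum_tentZ_sub_eq_one`)).

WHAT IS PROVED ([folklore]; `g_b(a) := sin(π∕2·tentZ L (a − (bL + c)))` on `ZMod N`, cubes `b : ZMod M`, `N = M·L`, `0 < L`, `2 ≤ M`):
* §1 `sq_sin_sub_add_sq_cos_sub_le` (`(sin u − sin v)² + (cos u − cos v)² ≤ (u − v)²`); **`sum_sq_sin_tent_step_le`** — `Σ_b (g_b(a+1) − g_b(a))² ≤ (π∕(2L))²`: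
  both sites' alive cubes lie in the pair `{q̄, q̄+1}` of `a` (TUS), the two tents there sum to `1` at `a` AND at `a+1` (`sum_tentZ_sub_eq_one`), so the pair of
  sines is `(sin(πθ∕2), cos(πθ∕2))` at both sites with `|θ′ − θ| ≤ 1∕L` (TZS) — §1's inequality with `u − v = π(θ′−θ)∕2`.
* §2 **`sum_sq_prod_update_sub_eq_of_sq`** — for ANY quadratic product partition (`Σ_s φ_s(y)² = 1` on every axis): `Σ_S (Π_μ φ_{S_μ}(x′_μ) − Π_μ φ_{S_μ}(x_μ))² =
  Σ_s (φ_s(y′) − φ_s(x_ν))²` when `x′ = update x ν y′` — an EQUALITY (TPP `prod_update_sub`, `Finset.sum_prod_piFinset`; the off-axis factors `Σ_s φ_s² = 1`);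
  `sum_sq_prod_sin_tent_add_one_le` ∕ `_sub_one_le` — the forward ∕ backward unit move of the sine-tent product costs `≤ (π∕(2L))²` summed over ALL cubes `S`.
* §3 **`sum_sq_prod_sin_tent_sub_le_of_disp`** — per-term `ℓ¹`-witnesses of length `≤ D` (`hdisp`, TPTo's shape) ⊢ `∀ j, ∀ b ∈ inc j,
  Σ_S (h_S(pt b) − h_S(pt (ref j)))² ≤ (D·(π∕(2L)))²` (TPTo `exists_chain` with `K :=` all cubes + PPaL `sum_sq_path_le_of_le`) — `…AdmissibleFloorSqLetter`'s `hsq` with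
  `Λ = D·π∕(2L)`; **`sum_sq_prod_sin_tent_sub_le_of_unit`** — the plaquette shape (`hunit`) ⊢ `≤ (π∕(2L))²`.
* §4 toy: `M = 2`, `L = 1`, `N = 2`: one step on `ℤ∕2` costs at most `(π∕2)²` (`example`).

NOT HERE (honest): the floors themselves (`…AdmissibleFloorSqLetter`, `…FullFormSineFloorSq`); the sharper `4sin²(π∕4L)` in place of `(π∕2L)²`; anything of Bałaban's.
BY-NAME EFFECT ON THE WALL: NONE (a partition letter of the (h2) slot; the wall is (R2)).  NE7b NOT PRINTED ∕ NOT PROVED; spine PROVED 0∕9; rung (B)+1 on ONE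
finite T⁴ — NOT infinite volume, NOT the mass gap, NOT Clay.
HONEST DEPENDENCY: continuum YM on T⁴ ⇐ BetaPertH ∧ nine spine estimates (0/9 proved); BetaPertH ⇐ (D1) ∧ (D4) ∧ CAP+tail; G-an2-4 gates asym, D1 and NE2/3/4.
-/

set_option autoImplicit false

noncomputable section

open Finset
open Literature.MathematicalPhysics.QuantumFieldTheory.Balaban1983to89.B14.TentUnityTorus (tentZ sum_tentZ_sub_eq_one)
open Summit.QuantumFields.BalabanUV.T4Continuum.NE7b.SineTentAxis (sin_tent_eq_zero_iff sum_sq_sin_tent_eq_one)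
open Summit.QuantumFields.BalabanUV.T4Continuum.NE7b.TentUnityTorusSupport (filter_tentZ_ne_zero_subset_pair filter_tentZ_ne_zero_add_one_subset_pair)
open Summit.QuantumFields.BalabanUV.T4Continuum.NE7b.TentUnityTorusSteps (abs_tentZ_add_one_sub_le)
open Summit.QuantumFields.BalabanUV.T4Continuum.NE7b.TentPartitionProduct (prod_update_sub)
open Summit.QuantumFields.BalabanUV.T4Continuum.NE7b.TentPartitionTorus (exists_chain hdisp_of_unit)
open Summit.QuantumFields.BalabanUV.T4Continuum.NE7b.PartitionPathLetters (sum_sq_path_le_of_le)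

namespace Summit.QuantumFields.BalabanUV.T4Continuum.NE7b.SineTentSqLetter

/-! ## §1 One axis: one lattice step costs at most `(π∕2L)²` in `ℓ²(cubes)` -/

/-- `(sin u − sin v)² + (cos u − cos v)² = 2 − 2cos(u − v) ≤ (u − v)²` (`cos t ≥ 1 − t²∕2`). [folklore] -/
theorem sq_sin_sub_add_sq_cos_sub_le (u v : ℝ) :
    (Real.sin u - Real.sin v) ^ 2 + (Real.cos u - Real.cos v) ^ 2 ≤ (u - v) ^ 2 := by
  have hid : (Real.sin u - Real.sin v) ^ 2 + (Real.cos u - Real.cos v) ^ 2 = 2 - 2 * Real.cos (u - v) := by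
    rw [Real.cos_sub]; nlinarith [Real.sin_sq_add_cos_sq u, Real.sin_sq_add_cos_sq v]
  rw [hid]
  linarith [Real.one_sub_sq_div_two_le_cos (x := u - v)]

/-- **ONE STEP ON AN AXIS: `Σ_b (g_b(a+1) − g_b(a))² ≤ (π∕(2L))²`** (`0 < L`, `2 ≤ M`, `N = M·L`; sharp up to `4sin²(π∕4L) ≤ (π∕2L)²`). [folklore] -/
theorem sum_sq_sin_tent_step_le (L M N : ℕ) [NeZero M] [NeZero N] (hL : 0 < L) (hM : 2 ≤ M) (hN : N = M * L) (c : ℕ) (a : ZMod N) :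
    ∑ b : ZMod M, (Real.sin (Real.pi / 2 * tentZ (L : ℝ) (a + 1 - ((b.val * L + c : ℕ) : ZMod N)))
        - Real.sin (Real.pi / 2 * tentZ (L : ℝ) (a - ((b.val * L + c : ℕ) : ZMod N)))) ^ 2 ≤ (Real.pi / (2 * L)) ^ 2 := by
  classical
  have hLr : (0 : ℝ) < L := by exact_mod_cast hL
  have hN2 : 2 ≤ N := by rw [hN]; nlinarith
  set q : ZMod M := (((a - (c : ZMod N)).val / L : ℕ) : ZMod M) with hq
  -- the pair has two distinct elements
  have hne : q ≠ q + 1 := by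
    intro h
    have h1 : (1 : ZMod M) = 0 := by
      have := congrArg (fun z => z - q) h
      simpa using this.symm
    haveI : Fact (1 < M) := ⟨by omega⟩
    exact one_ne_zero h1
  -- both tents vanish off the pair, at `a` and at `a + 1`
  have hvan0 : ∀ b, b ∉ ({q, q + 1} : Finset (ZMod M)) → tentZ (L : ℝ) (a - ((b.val * L + c : ℕ) : ZMod N)) = 0 := by
    intro b hb
    by_contra hne0
    exact hb (filter_tentZ_ne_zero_subset_pair L M N hL hN c a (Finset.mem_filter.mpr ⟨Finset.mem_univ _, hne0⟩))
  have hvan1 : ∀ b, b ∉ ({q, q + 1} : Finset (ZMod M)) → tentZ (L : ℝ) (a + 1 - ((b.val * L + c : ℕ) : ZMod N)) = 0 := by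
    intro b hb
    by_contra hne0
    exact hb (filter_tentZ_ne_zero_add_one_subset_pair L M N hL hM hN c a (Finset.mem_filter.mpr ⟨Finset.mem_univ _, hne0⟩))
  -- the tents on the pair sum to one, at `a` and at `a + 1`
  have hsum0 : tentZ (L : ℝ) (a - ((q.val * L + c : ℕ) : ZMod N)) + tentZ (L : ℝ) (a - (((q + 1).val * L + c : ℕ) : ZMod N)) = 1 := by
    rw [← sum_tentZ_sub_eq_one L M hL hM N hN c a, ← Finset.sum_subset (Finset.subset_univ ({q, q + 1} : Finset (ZMod M)))
      (fun b _ hb => hvan0 b hb), Finset.sum_pair hne]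
  have hsum1 : tentZ (L : ℝ) (a + 1 - ((q.val * L + c : ℕ) : ZMod N)) + tentZ (L : ℝ) (a + 1 - (((q + 1).val * L + c : ℕ) : ZMod N)) = 1 := by
    rw [← sum_tentZ_sub_eq_one L M hL hM N hN c (a + 1), ← Finset.sum_subset (Finset.subset_univ ({q, q + 1} : Finset (ZMod M)))
      (fun b _ hb => hvan1 b hb), Finset.sum_pair hne]
  -- reduce the sum to the pair
  rw [← Finset.sum_subset (Finset.subset_univ ({q, q + 1} : Finset (ZMod M))) (fun b _ hb => by
      rw [(sin_tent_eq_zero_iff hLr _).mpr (hvan0 b hb), (sin_tent_eq_zero_iff hLr _).mpr (hvan1 b hb), sub_zero, zero_pow two_ne_zero]),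
    Finset.sum_pair hne]
  -- the pair of sines is `(sin(πθ∕2), cos(πθ∕2))` at both sites
  set θ₀ := tentZ (L : ℝ) (a - ((q.val * L + c : ℕ) : ZMod N)) with hθ₀
  set θ₁ := tentZ (L : ℝ) (a + 1 - ((q.val * L + c : ℕ) : ZMod N)) with hθ₁
  have hθ₀' : tentZ (L : ℝ) (a - (((q + 1).val * L + c : ℕ) : ZMod N)) = 1 - θ₀ := by linarith
  have hθ₁' : tentZ (L : ℝ) (a + 1 - (((q + 1).val * L + c : ℕ) : ZMod N)) = 1 - θ₁ := by linarith
  rw [hθ₀', hθ₁', show Real.pi / 2 * (1 - θ₀) = Real.pi / 2 - Real.pi / 2 * θ₀ by ring,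
    show Real.pi / 2 * (1 - θ₁) = Real.pi / 2 - Real.pi / 2 * θ₁ by ring, Real.sin_pi_div_two_sub, Real.sin_pi_div_two_sub]
  -- the tent moves by at most `1∕L`
  have hstep : |θ₁ - θ₀| ≤ 1 / L := by
    have heq : a + 1 - ((q.val * L + c : ℕ) : ZMod N) = a - ((q.val * L + c : ℕ) : ZMod N) + 1 := by ring
    rw [hθ₁, hθ₀, heq]
    exact abs_tentZ_add_one_sub_le hLr hN2 _
  calc (Real.sin (Real.pi / 2 * θ₁) - Real.sin (Real.pi / 2 * θ₀)) ^ 2 + (Real.cos (Real.pi / 2 * θ₁) - Real.cos (Real.pi / 2 * θ₀)) ^ 2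
      ≤ (Real.pi / 2 * θ₁ - Real.pi / 2 * θ₀) ^ 2 := sq_sin_sub_add_sq_cos_sub_le _ _
    _ = (Real.pi / 2) ^ 2 * |θ₁ - θ₀| ^ 2 := by rw [sq_abs]; ring
    _ ≤ (Real.pi / 2) ^ 2 * (1 / L) ^ 2 :=
        mul_le_mul_of_nonneg_left (pow_le_pow_left₀ (abs_nonneg _) hstep 2) (sq_nonneg _)
    _ = (Real.pi / (2 * L)) ^ 2 := by field_simp

/-! ## §2 Quadratic product partitions: a one-axis move costs exactly the one-axis letter -/

section Product

variable {A ι X : Type*} [Fintype A] [DecidableEq A] [Fintype ι]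

/-- **QUADRATIC PRODUCT PARTITIONS — ONE-AXIS MOVES, AN EQUALITY**: if `Σ_s φ_s(y)² = 1` for every `y`, then for `x′ = update x ν y′`
`Σ_S (Π_μ φ_{S_μ}(x′_μ) − Π_μ φ_{S_μ}(x_μ))² = Σ_s (φ_s(y′) − φ_s(x_ν))²` (the off-axis factors contribute `Π_{μ≠ν} Σ_s φ_s(x_μ)² = 1`). [folklore] -/
theorem sum_sq_prod_update_sub_eq_of_sq (φ : ι → X → ℝ) (hsq : ∀ y, ∑ s, φ s y ^ 2 = 1) (x : A → X) (ν : A) (y' : X) :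
    ∑ S : A → ι, (∏ μ, φ (S μ) (Function.update x ν y' μ) - ∏ μ, φ (S μ) (x μ)) ^ 2
      = ∑ s, (φ s y' - φ s (x ν)) ^ 2 := by
  -- the weight family `g_μ(s)`: the squared step on the axis `ν`, the squared partition elsewhere
  set g : A → ι → ℝ := fun μ s => if μ = ν then (φ s y' - φ s (x ν)) ^ 2 else φ s (x μ) ^ 2 with hg
  have hterm : ∀ S : A → ι,
      (∏ μ, φ (S μ) (Function.update x ν y' μ) - ∏ μ, φ (S μ) (x μ)) ^ 2 = ∏ μ, g μ (S μ) := by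
    intro S
    rw [prod_update_sub, mul_pow, ← Finset.prod_pow,
      ← Finset.mul_prod_erase Finset.univ (fun μ => g μ (S μ)) (Finset.mem_univ ν), mul_comm]
    congr 1
    · simp only [hg, if_true]
    · exact Finset.prod_congr rfl fun μ hμ => by simp only [hg, if_neg (Finset.ne_of_mem_erase hμ)]
  have hfac : ∑ S : A → ι, ∏ μ, g μ (S μ) = ∏ μ, ∑ s, g μ s := by
    have h := Finset.sum_prod_piFinset (Finset.univ : Finset ι) g
    rw [Fintype.piFinset_univ] at h
    exact h
  have hfactors : ∏ μ, ∑ s, g μ s = ∑ s, (φ s y' - φ s (x ν)) ^ 2 := by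
    rw [← Finset.mul_prod_erase Finset.univ (fun μ => ∑ s, g μ s) (Finset.mem_univ ν)]
    have hν : ∑ s, g ν s = ∑ s, (φ s y' - φ s (x ν)) ^ 2 := by simp only [hg, if_true]
    have hrest : ∏ μ ∈ Finset.univ.erase ν, ∑ s, g μ s = 1 :=
      Finset.prod_eq_one fun μ hμ => by simp only [hg, if_neg (Finset.ne_of_mem_erase hμ), hsq]
    rw [hν, hrest, mul_one]
  rw [Finset.sum_congr rfl fun S _ => hterm S, hfac, hfactors]

end Product

variable {A : Type*} [Fintype A] [DecidableEq A]

/-- **FORWARD UNIT MOVE OF THE SINE-TENT PRODUCT**: `Σ_S (h_S(update ξ ν (ξ ν + 1)) − h_S(ξ))² ≤ (π∕(2L))²`, summed over ALL cubes `S : A → ZMod M`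
(§2's equality, then §1 on the axis `ν`). [folklore] -/
theorem sum_sq_prod_sin_tent_add_one_le (L M N : ℕ) [NeZero M] [NeZero N] (hL : 0 < L) (hM : 2 ≤ M) (hN : N = M * L) (c : ℕ)
    (ξ : A → ZMod N) (ν : A) :
    ∑ S : A → ZMod M, (∏ μ, Real.sin (Real.pi / 2 * tentZ (L : ℝ) (Function.update ξ ν (ξ ν + 1) μ - (((S μ).val * L + c : ℕ) : ZMod N)))
        - ∏ μ, Real.sin (Real.pi / 2 * tentZ (L : ℝ) (ξ μ - (((S μ).val * L + c : ℕ) : ZMod N)))) ^ 2 ≤ (Real.pi / (2 * L)) ^ 2 := by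
  rw [sum_sq_prod_update_sub_eq_of_sq
    (fun (b : ZMod M) (a : ZMod N) => Real.sin (Real.pi / 2 * tentZ (L : ℝ) (a - ((b.val * L + c : ℕ) : ZMod N))))
    (fun a => sum_sq_sin_tent_eq_one L M N hL hM hN c a) ξ ν (ξ ν + 1)]
  exact sum_sq_sin_tent_step_le L M N hL hM hN c (ξ ν)

/-- **BACKWARD UNIT MOVE**: `Σ_S (h_S(update ξ ν (ξ ν − 1)) − h_S(ξ))² ≤ (π∕(2L))²` (the forward move from `update ξ ν (ξ ν − 1)` lands on `ξ`; squares are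
symmetric). [folklore] -/
theorem sum_sq_prod_sin_tent_sub_one_le (L M N : ℕ) [NeZero M] [NeZero N] (hL : 0 < L) (hM : 2 ≤ M) (hN : N = M * L) (c : ℕ)
    (ξ : A → ZMod N) (ν : A) :
    ∑ S : A → ZMod M, (∏ μ, Real.sin (Real.pi / 2 * tentZ (L : ℝ) (Function.update ξ ν (ξ ν - 1) μ - (((S μ).val * L + c : ℕ) : ZMod N)))
        - ∏ μ, Real.sin (Real.pi / 2 * tentZ (L : ℝ) (ξ μ - (((S μ).val * L + c : ℕ) : ZMod N)))) ^ 2 ≤ (Real.pi / (2 * L)) ^ 2 := by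
  set ξ' : A → ZMod N := Function.update ξ ν (ξ ν - 1) with hξ'
  have hback : Function.update ξ' ν (ξ' ν + 1) = ξ := by
    rw [hξ', Function.update_self, sub_add_cancel, Function.update_idem, Function.update_eq_self]
  have h := sum_sq_prod_sin_tent_add_one_le L M N hL hM hN c ξ' ν
  rw [hback] at h
  refine le_of_eq_of_le (Finset.sum_congr rfl fun S _ => ?_) h
  rw [← neg_sub, neg_sq]

/-! ## §3 Terms: `D` moves give `Σ_S (h_S(pt b) − h_S(pt ref))² ≤ (D·π∕(2L))²` — `…AdmissibleFloorSqLetter`'s `hsq` -/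

/-- **THE SUMMED-SQUARE DISPLACEMENT LETTER OF THE SINE-TENT PARTITION**: bonds read at torus sites `pt` with per-term `ℓ¹`-witnesses of length `≤ D` from
`ref j` ⊢ `Σ_S (h_S(pt b) − h_S(pt (ref j)))² ≤ (D·(π∕(2L)))²` for every `b ∈ inc j` (TPTo `exists_chain` over ALL cubes + PPaL `sum_sq_path_le_of_le`). [folklore] -/
theorem sum_sq_prod_sin_tent_sub_le_of_disp (L M N : ℕ) [NeZero M] [NeZero N] (hL : 0 < L) (hM : 2 ≤ M) (hN : N = M * L) (c : ℕ)
    {C J : Type*} (pt : C → A → ZMod N) (inc : J → Finset C) (ref : J → C) (D : ℕ)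
    (hdisp : ∀ j, ∀ b ∈ inc j, ∃ wp wm : A → ℕ,
      pt b = pt (ref j) + (fun ν => ((wp ν : ℕ) : ZMod N)) - (fun ν => ((wm ν : ℕ) : ZMod N)) ∧ ∑ ν, wp ν + ∑ ν, wm ν ≤ D) :
    ∀ (j : J), ∀ b ∈ inc j,
      ∑ S : A → ZMod M, (∏ ν, Real.sin (Real.pi / 2 * tentZ (L : ℝ) (pt b ν - (((S ν).val * L + c : ℕ) : ZMod N)))
        - ∏ ν, Real.sin (Real.pi / 2 * tentZ (L : ℝ) (pt (ref j) ν - (((S ν).val * L + c : ℕ) : ZMod N)))) ^ 2 ≤ (D * (Real.pi / (2 * L))) ^ 2 := by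
  intro j b hb
  have hβ : (0 : ℝ) ≤ Real.pi / (2 * L) := by positivity
  obtain ⟨wp, wm, hpt, hD⟩ := hdisp j b hb
  obtain ⟨p, hp0, hpn, hps⟩ := exists_chain (K := A → ZMod M)
    (fun (S : A → ZMod M) (ζ : A → ZMod N) => ∏ ν, Real.sin (Real.pi / 2 * tentZ (L : ℝ) (ζ ν - (((S ν).val * L + c : ℕ) : ZMod N))))
    (β := (Real.pi / (2 * L)) ^ 2)
    (fun ζ ν => sum_sq_prod_sin_tent_add_one_le L M N hL hM hN c ζ ν)
    (fun ζ ν => sum_sq_prod_sin_tent_sub_one_le L M N hL hM hN c ζ ν)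
    wp wm (pt (ref j))
  have hpath := sum_sq_path_le_of_le (K := A → ZMod M)
    (fun (S : A → ZMod M) (ζ : A → ZMod N) => ∏ ν, Real.sin (Real.pi / 2 * tentZ (L : ℝ) (ζ ν - (((S ν).val * L + c : ℕ) : ZMod N))))
    p hβ hD hps
  rw [hp0, hpn, ← hpt] at hpath
  exact hpath

/-- **… IN THE PLAQUETTE SHAPE** (`hunit`: every bond at the reference site or ONE FORWARD unit move from it): `Σ_S (h_S(pt b) − h_S(pt (ref j)))² ≤ (π∕(2L))²`.
[folklore] -/
theorem sum_sq_prod_sin_tent_sub_le_of_unit (L M N : ℕ) [NeZero M] [NeZero N] (hL : 0 < L) (hM : 2 ≤ M) (hN : N = M * L) (c : ℕ)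
    {C J : Type*} (pt : C → A → ZMod N) (inc : J → Finset C) (ref : J → C)
    (hunit : ∀ j, ∀ b ∈ inc j, pt b = pt (ref j) ∨ ∃ ν, pt b = Function.update (pt (ref j)) ν (pt (ref j) ν + 1)) :
    ∀ (j : J), ∀ b ∈ inc j,
      ∑ S : A → ZMod M, (∏ ν, Real.sin (Real.pi / 2 * tentZ (L : ℝ) (pt b ν - (((S ν).val * L + c : ℕ) : ZMod N)))
        - ∏ ν, Real.sin (Real.pi / 2 * tentZ (L : ℝ) (pt (ref j) ν - (((S ν).val * L + c : ℕ) : ZMod N)))) ^ 2 ≤ (Real.pi / (2 * L)) ^ 2 := by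
  intro j b hb
  rcases hunit j b hb with he | ⟨ν, hν⟩
  · rw [he]
    simp only [sub_self, zero_pow two_ne_zero, Finset.sum_const_zero]
    positivity
  · rw [hν]
    exact sum_sq_prod_sin_tent_add_one_le L M N hL hM hN c (pt (ref j)) ν

/-! ## §4 Toy: two cubes of one site, one step -/

/- `M = 2`, `L = 1`, `N = 2`, `c = 0`: a step on `ℤ∕2ℤ` moves the pair of sines by at most `(π∕2)²` in `ℓ²`. -/
example (a : ZMod 2) :
    ∑ b : ZMod 2, (Real.sin (Real.pi / 2 * tentZ ((1 : ℕ) : ℝ) (a + 1 - ((b.val * 1 + 0 : ℕ) : ZMod 2)))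
        - Real.sin (Real.pi / 2 * tentZ ((1 : ℕ) : ℝ) (a - ((b.val * 1 + 0 : ℕ) : ZMod 2)))) ^ 2 ≤ (Real.pi / (2 * (1 : ℕ))) ^ 2 :=
  sum_sq_sin_tent_step_le 1 2 2 one_pos le_rfl rfl 0 a

end Summit.QuantumFields.BalabanUV.T4Continuum.NE7b.SineTentSqLetter

end
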